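/-
Copyright (c) 2026 the pub-hodgecm-mathlib formalisation cell (harness21).  Prover seat hodgecm-mathlib-LH4-p13 (g10), req620 Track A «(D-RAM) FOUR-FRAME» squad
F0∕P3c∕LH4; the (β₂) road (R-36), β₂ WORDs #34∕#36 «THE MIX-HI WALL» (lead LH4-p13, second LH7-p09 (g3)): the two letters' predicates `NX`, `Pc` READ ON THE DIGIT of any
frame of any member (★ p864839 ∘ ★ p864871); helper lane on h413 = stmt-HodgeConjecture-24833 (count-neutral).  2026-09-05.
-/
import Summits.HodgeConjecture.HodgeConjecture.Theorems.F0P3cDyRamMixBandProductClassOfMember   -- ★ p864839 (this seat): `exactDigit_and_prodClass_of_presentation`; brings ★ p864672's frame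
import Summits.HodgeConjecture.HodgeConjecture.Theorems.F0P3cDyRamRayScalarGluePairingE           -- ★ p864871 (LH7-p10 (g3)): `rayScalar_eq_pairing_mul_on_E`, `prodClass_iff_digitClass`, `v_rayScalar_eq_iff_of_eq`
import HarnessLib

/-!
# Crux `H413`, line LH4 «(D-RAM) FOUR-FRAME» — STAGE-1b, row (2) of `f_{T₊}`, the (β₂) road (R-36), the MIX-HI WALL (β₂ WORDs #34∕#36): «THE TWO MIX-HI PREDICATES READ ON
# THE DIGIT» — at ANY frame `(x₀, w₀)` of ANY member `Λ` (populated or not) with affine digit value `a` (`jE a = ρμ + (μ − ρμ)·κ̂(u₀)`, `u₀ = h·x₀Θx₀`):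
# `NX Λ ⟺ |⟨w₀,w₀⟩|·|a| = |ϖ|^{ℓ₀}` and, for every `σ`-fixed unit `e′` with `|⟨w₀,w₀⟩·a − e′t₊| ≤ |ϖ|^{m⋆}`, `Pc Λ ⟺ −(e′∕⟨w₀,w₀⟩)∕h_W ∈ N(E^×)`

Cell `hodgecm-mathlib` (D-0151), FLOOR 0, crux item H413 = `stmt-HodgeConjecture-24833`, route of record `HCCMUnconditional`; squads F0∕P3c∕LH4 ∕ LH7; lane
`--supports stmt-HodgeConjecture-24833 --as helper` (count-neutral; pays NO tier-0 row).  THEOREMS ONLY (no `def`, no instance, no notation, no `sorry`, default heartbeats);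
★-only imports; states NO law; ‹PRODBAL-U›∕‹PRODBAL-D› and (β₂) stay HYPOTHESES.  Frame = ★ p864839's VERBATIM; per member additionally the glue vector `w₀` of the frame
(`φ w₀ = Y(x₀)⁻¹x₀`), `σ⟨w₀,w₀⟩ = ⟨w₀,w₀⟩ ≠ 0`, `Tr_ρ u₀ ≠ 0` (★ p864444 `exists_vertexFrame_of_gen` outputs) and the digit value `a`.

WHY (MIX-HI lead; the lattice-half typist LH4-p06 (g10) of ‹PRODBAL-U∕D› = `#{Λ ∈ cell ∣ NX Λ ∧ Pc Λ} = #{Λ ∈ cell ∣ NX Λ ∧ ¬ Pc Λ}` (★ p864724∕p864725) reads both predicates as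
DIGIT predicates at one frame per member; this file is the discharger of those two reads, so that the digit worker imports them BY NAME).  ★ p864839 reads `NX`, `Pc` at any
presentation through the ray scalar `e₀` and the glue unit `r₀`; ★ p864871 (LH7-p10's E-kernel) rewrites `e₀ = ⟨w₀,w₀⟩·a` (★ p864387 HEAD′ on `E`) and
`r₀·e′ ∈ N ⟺ −(e′∕⟨w₀,w₀⟩)∕h_W ∈ N` (the glue pairing's class CANCELS).  HEAD `digitReads_of_presentation` composes the two: the predicates of the letters are the VALUE SPHERE
`|⟨w₀,w₀⟩|·|a| = |t₊|` and the AFFINE SIGN `ω(−(e′∕⟨w₀,w₀⟩)∕h_W)` of the digit (in LH4-p19's coordinate `V`, `a ∝ α₁ + γ₁·V`; ★ p864820 (B2) sums such signs over value spheres).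
HONEST LABEL.  Count-neutral composition of ★ pieces; nothing printed is asserted; no census law is stated; ‹PRODBAL-U∕D›, the MIX-HI band letters and (β₂) `stub_law_cleanSgn₂` stay
OPEN; `HC_CM` is proved only modulo the 7 printed citations (2 remaining named inputs: hLiu418 = `stmt-HodgeConjecture-24832`, h413 = `stmt-HodgeConjecture-24833`) until rung 0 closes.
## References
* [Rogawski1990] J. D. Rogawski, *Automorphic Representations of Unitary Groups in Three Variables*, Ann. of Math. Stud. 123 (1990): §4.9 Prop. 4.9.1 (b) p. 55.
* [Kottwitz1986BaseChangeUnits] R. E. Kottwitz, *Base change for unit elements of Hecke algebras*, Compositio Math. 60 (1986): §1 pp. 240–241; §3.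
* [Jacobowitz1962] R. Jacobowitz, *Hermitian forms over local fields*, Amer. J. Math. 84 (1962): §4 (duals, gluing, the glue unit).
* [Serre1979] J.-P. Serre, *Local Fields*, GTM 67 (1979): Ch. V §3 Prop. 5, Cor. 2–3 pp. 84–86 (norm classes of units: index two); Ch. III §6 Prop. 12.
-/

set_option autoImplicit false

noncomputable section

namespace Summit.HodgeConjecture.HodgeConjecture.Cruxes.H413.F0P3cDyRamMixBandDigitReads

open scoped Valued WithZero Matrix MatrixGroups Pointwise
open WithZero
open Literature.NumberTheory.Automorphic Literature.NumberTheory.Automorphic.HermitianLattice Literature.NumberTheory.Automorphic.UnitaryLatticeTree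
open Literature.NumberTheory.Automorphic.UnitaryThreeFourFrame (IsRamifiedQuadraticDatum)
open Literature.NumberTheory.Automorphic.EllipticPlaneAsFieldLine
open Literature.NumberTheory.Rogawski1990
open Summit.HodgeConjecture.HodgeConjecture.Cruxes.H413.F0P3cDyRamFourFramePieces
open Summit.HodgeConjecture.HodgeConjecture.Cruxes.H413.F0P3cDyRamFourFrameCensusDefs (LatticeInLevel LatticeNearTransvShell)
open Summit.HodgeConjecture.HodgeConjecture.Cruxes.H413.F0P3cDyRamStageOneBDefs (mcOfRecord)
open Summit.HodgeConjecture.HodgeConjecture.Cruxes.H413.F0P3cDyRamToricCensusDefs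
open Summit.HodgeConjecture.HodgeConjecture.Cruxes.H413.F0P3cDyRamMixBandProductClassOfMember (exactDigit_and_prodClass_of_presentation)
open Summit.HodgeConjecture.HodgeConjecture.Cruxes.H413.F0P3cDyRamRayScalarGluePairingE (rayScalar_eq_pairing_mul_on_E prodClass_iff_digitClass v_rayScalar_eq_iff_of_eq)

variable {E M : Type} [Field E] [Valued E ℤᵐ⁰] [Field M] [Valued M ℤᵐ⁰] {ρ Θ : M →+* M} {α : M}

/-- **HEAD — «THE TWO MIX-HI PREDICATES READ ON THE DIGIT».**  Frame of ★ p864839 VERBATIM.  THEN for every member `Λ` of `levelSetDep(j, b; lam − jE u₀₀)` (populated or not),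
every presentation `x₀`, every `σ`-fixed unit `r₀` with `jE r₀ = glueUnit(x₀, b)`, every glue vector `w₀` with `φ w₀ = Y(x₀)⁻¹x₀` and `σ⟨w₀,w₀⟩ = ⟨w₀,w₀⟩ ≠ 0`, `Tr_ρ u₀ ≠ 0`
(`u₀ = h·x₀Θx₀`), and every `a : E` with `jE a = ρμ + (μ − ρμ)·(ρu₀∕(u₀ + ρu₀))`:  `(NX Λ ↔ |⟨w₀,w₀⟩|·|a| = |ϖ|^{d % 2})` and, for every `σ`-fixed unit `e′` with
`|⟨w₀,w₀⟩·a − e′·t₊| ≤ |ϖ|^{m⋆}`, `(Pc Λ ↔ ∃ c, c·σc = −(e′∕⟨w₀,w₀⟩)∕h_W)`. [cite: Rogawski1990, §4.9 Prop. 4.9.1 (b) p. 55] [cite: Kottwitz1986BaseChangeUnits, §1 pp. 240–241; §3]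
[cite: Serre1979, Ch. V §3 Prop. 5, Cor. 2–3 pp. 84–86] [cite: Jacobowitz1962, §4] -/
theorem digitReads_of_presentation [CompleteSpace E] [IsDiscreteValuationRing 𝒪[E]] [Finite 𝓀[E]]
    (σ : E →+* E) (hσ : ∀ a, σ (σ a) = a) (hvσ : ∀ a, Valued.v (σ a) = Valued.v a) {ϖ : E} (hϖ : Valued.v ϖ = exp (-1 : ℤ))
    {d t : ℕ} (hD : IsRamifiedQuadraticDatum σ ϖ d t) (h2 : ¬ IsUnit (2 : 𝒪[E])) (h2v : Valued.v (2 : E) < 1)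
    {H₂ : Matrix (Fin 2) (Fin 2) E} (hH₂ : IsUnit H₂.det) (hH₂σ : (H₂.map σ)ᵀ = H₂) {hW : E} (hhW : Valued.v hW = 1) (hhWσ : σ hW = hW)
    (jE : E →+* M) (hρρ : ∀ x, ρ (ρ x) = x) (hvρ : ∀ x, Valued.v (ρ x) = Valued.v x) (hα : ρ α ≠ α) (hα1 : Valued.v α ≤ 1)
    (hint : ∀ z : M, Valued.v z ≤ 1 → Valued.v ((z - ρ z) / (α - ρ α)) ≤ 1)
    (hΘΘ : ∀ x, Θ (Θ x) = x) (hΘρ : ∀ x, Θ (ρ x) = ρ (Θ x)) (hvΘ : ∀ x, Valued.v (Θ x) = Valued.v x) (hΘj : ∀ c, Θ (jE c) = jE (σ c))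
    (hjv : ∀ c, Valued.v (jE c) ≤ 1 ↔ Valued.v c ≤ 1) (hjiso : ∀ c, Valued.v (jE c) = Valued.v c) (hjfix : ∀ z, ρ z = z ↔ ∃ c, jE c = z)
    (hjpow : ∀ (t : E) (n : ℤ), Valued.v (jE t) = Valued.v (jE ϖ) ^ n ↔ Valued.v t = Valued.v ϖ ^ n)
    (hϖmax : ∀ t : M, ρ t = t → Valued.v t < 1 → Valued.v t ≤ Valued.v (jE ϖ))
    (φ : (Fin 2 → E) →+ M) (hφs : ∀ (c : E) (x : Fin 2 → E), φ (c • x) = jE c * φ x) (hφi : Function.Injective φ) (hφo : Function.Surjective φ)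
    {γ₂ : GL (Fin 2) E} {lam h : M} (hφγ : ∀ x, φ ((γ₂ : Matrix (Fin 2) (Fin 2) E).mulVec x) = lam * φ x) (hlam : Valued.v lam = 1)
    (hΘh : Θ h = h) (hh : h ≠ 0) (hform : ∀ x y, jE (pairing σ H₂ x y) = h * Θ (φ x) * φ y + ρ (h * Θ (φ x) * φ y))
    -- the literal `(γ₂, u)`: `lam`'s characteristic polynomial and the unitary embedding (★ p861305 §3's general block, for the label law ★ p864323 §3)
    (hlam2 : lam * lam = jE (γ₂ : Matrix (Fin 2) (Fin 2) E).trace * lam - jE (γ₂ : Matrix (Fin 2) (Fin 2) E).det)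
    (hρlam : ρ lam = jE (γ₂ : Matrix (Fin 2) (Fin 2) E).trace - lam) (u : GL (Fin 1) E)
    (P₁ : GL (Fin 3) E) (hA : formCongr σ P₁ ((StdForm.antidiagonal 3).over E) = (!![H₂ 0 0, 0, H₂ 0 1; 0, hW, 0; H₂ 1 0, 0, H₂ 1 1] : Matrix (Fin 3) (Fin 3) E))
    (hΓ : P₁ * endoGL (γ₂, u) * P₁⁻¹ ∈ unitaryGroupOfForm σ ((StdForm.antidiagonal 3).over E))
    -- the fence
    {n : ℕ} (hn : mcOfRecord d ≤ n) (hu1N : Valued.v (((u : Matrix (Fin 1) (Fin 1) E) 0 0) - 1) ≤ Valued.v (ϖ ^ n)) (hlam1 : Valued.v (lam - 1) ≤ Valued.v (jE ϖ ^ n))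
    -- the cell and its four letters
    {b j : ℕ} (hb1 : 1 ≤ b) (hdb : d ≤ b) (hlamj : IsOrd ρ α (jE ϖ ^ j) lam)
    (hμl : Valued.v (lam - jE ((u : Matrix (Fin 1) (Fin 1) E) 0 0)) ≤ Valued.v (jE ϖ) ^ (d % 2 + 1 + b))
    (hlamρ : Valued.v (lam - ρ lam) ≤ Valued.v (jE ϖ ^ j * (α - ρ α)) * Valued.v (jE ϖ) ^ (d % 2 + 1))
    (hμk : Valued.v (lam - jE ((u : Matrix (Fin 1) (Fin 1) E) 0 0)) ≤ Valued.v (jE ϖ) ^ (mcOfRecord d - d % 2))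
    (hprod : Valued.v (lam - jE ((u : Matrix (Fin 1) (Fin 1) E) 0 0)) * Valued.v ((lam - jE ((u : Matrix (Fin 1) (Fin 1) E) 0 0)) - ρ (lam - jE ((u : Matrix (Fin 1) (Fin 1) E) 0 0))) ≤
      Valued.v (jE ϖ ^ j * (α - ρ α)) * Valued.v (jE ϖ) ^ b * Valued.v (jE ϖ) ^ mcOfRecord d)
    -- ★ (C1)'s weight letter
    (f : ℕ → ℕ → AddSubgroup M → ℕ)
    (hf : ∀ (b j : ℕ) (Λ : AddSubgroup M) (x₀ : M) (r : E), 1 ≤ b → x₀ ≠ 0 →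
      (∀ x, x ∈ Λ ↔ ∃ z, IsOrd ρ α (jE ϖ ^ j) z ∧ x = x₀ * z) →
      IsOrd ρ α (jE ϖ ^ j) (dualGen ρ Θ α (jE ϖ ^ j) h x₀) → ¬ IsOrd ρ α (jE ϖ ^ j) (dualGen ρ Θ α (jE ϖ ^ j) h x₀ / jE ϖ) →
      Valued.v (dualGen ρ Θ α (jE ϖ ^ j) h x₀) = Valued.v (jE ϖ) ^ b →
      (∀ b', (∀ x ∈ Λ, Valued.v (h * Θ x * b' + ρ (h * Θ x * b')) ≤ 1) → (lam - jE ((u : Matrix (Fin 1) (Fin 1) E) 0 0)) * b' ∈ Λ) →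
      IsOrd ρ α (jE ϖ ^ j) lam → jE r = glueUnit ρ Θ α (jE ϖ ^ j) h (jE ϖ) (jE hW) x₀ b →
      f b j Λ = Nat.card {x : 𝒪[E] ⧸ 𝓂[E] ^ (2 * b) // ∃ u' : 𝒪[E], Ideal.Quotient.mk (𝓂[E] ^ (2 * b)) u' = x ∧
        Valued.v ((u' : E) * σ u' - r) ≤ Valued.v (ϖ ^ (2 * b))})
    -- the exact-level digit and the product class
    (NX : AddSubgroup M → Prop)
    (hNX : ∀ Λ, NX Λ ↔ ∃ (x₀ : M) (e₀ : E), x₀ ≠ 0 ∧ (∀ x, x ∈ Λ ↔ ∃ ζ, IsOrd ρ α (jE ϖ ^ j) ζ ∧ x = x₀ * ζ) ∧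
      IsOrd ρ α (jE ϖ ^ j) (dualGen ρ Θ α (jE ϖ ^ j) h x₀) ∧ ¬ IsOrd ρ α (jE ϖ ^ j) (dualGen ρ Θ α (jE ϖ ^ j) h x₀ / jE ϖ) ∧
      Valued.v (dualGen ρ Θ α (jE ϖ ^ j) h x₀) = Valued.v (jE ϖ) ^ b ∧
      jE e₀ = (lam - jE ((u : Matrix (Fin 1) (Fin 1) E) 0 0)) / (jE ϖ ^ j * (α - ρ α) * Θ (dualGen ρ Θ α (jE ϖ ^ j) h x₀)) +
        ρ ((lam - jE ((u : Matrix (Fin 1) (Fin 1) E) 0 0)) / (jE ϖ ^ j * (α - ρ α) * Θ (dualGen ρ Θ α (jE ϖ ^ j) h x₀))) ∧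
      Valued.v e₀ = Valued.v ϖ ^ (d % 2))
    (Pc : AddSubgroup M → Prop)
    (hPc : ∀ Λ, Pc Λ ↔ ∃ (x₀ : M) (r e₀ e' : E), x₀ ≠ 0 ∧ (∀ x, x ∈ Λ ↔ ∃ ζ, IsOrd ρ α (jE ϖ ^ j) ζ ∧ x = x₀ * ζ) ∧
      IsOrd ρ α (jE ϖ ^ j) (dualGen ρ Θ α (jE ϖ ^ j) h x₀) ∧ ¬ IsOrd ρ α (jE ϖ ^ j) (dualGen ρ Θ α (jE ϖ ^ j) h x₀ / jE ϖ) ∧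
      Valued.v (dualGen ρ Θ α (jE ϖ ^ j) h x₀) = Valued.v (jE ϖ) ^ b ∧
      σ r = r ∧ Valued.v r = 1 ∧ jE r = glueUnit ρ Θ α (jE ϖ ^ j) h (jE ϖ) (jE hW) x₀ b ∧
      jE e₀ = (lam - jE ((u : Matrix (Fin 1) (Fin 1) E) 0 0)) / (jE ϖ ^ j * (α - ρ α) * Θ (dualGen ρ Θ α (jE ϖ ^ j) h x₀)) +
        ρ ((lam - jE ((u : Matrix (Fin 1) (Fin 1) E) 0 0)) / (jE ϖ ^ j * (α - ρ α) * Θ (dualGen ρ Θ α (jE ϖ ^ j) h x₀))) ∧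
      σ e' = e' ∧ Valued.v e' = 1 ∧ Valued.v (e₀ - e' * ((ϖ - σ ϖ) * ((ϖ * σ ϖ) ^ ((d - d % 2) / 2))⁻¹)) ≤ Valued.v ϖ ^ mstarOfRecord d ∧
      ∃ c : E, c * σ c = r * e')
    (z : M) (hz1 : Valued.v z = 1) (ξ₀ : E) (hzξ : z * Θ z = jE ξ₀) (hσξ : σ ξ₀ = ξ₀) (hξN : ¬ ∃ e : E, e * σ e = ξ₀) :
    ∀ Λ ∈ levelSetDep ρ Θ α (jE ϖ) h j b (lam - jE ((u : Matrix (Fin 1) (Fin 1) E) 0 0)),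
      ∀ (x₀ : M) (r₀ : E) (w₀ : Fin 2 → E) (a : E), x₀ ≠ 0 → (∀ x, x ∈ Λ ↔ ∃ ζ, IsOrd ρ α (jE ϖ ^ j) ζ ∧ x = x₀ * ζ) →
        IsOrd ρ α (jE ϖ ^ j) (dualGen ρ Θ α (jE ϖ ^ j) h x₀) → ¬ IsOrd ρ α (jE ϖ ^ j) (dualGen ρ Θ α (jE ϖ ^ j) h x₀ / jE ϖ) →
        Valued.v (dualGen ρ Θ α (jE ϖ ^ j) h x₀) = Valued.v (jE ϖ) ^ b →
        σ r₀ = r₀ → Valued.v r₀ = 1 → jE r₀ = glueUnit ρ Θ α (jE ϖ ^ j) h (jE ϖ) (jE hW) x₀ b →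
        φ w₀ = (dualGen ρ Θ α (jE ϖ ^ j) h x₀)⁻¹ * x₀ → σ (pairing σ H₂ w₀ w₀) = pairing σ H₂ w₀ w₀ → pairing σ H₂ w₀ w₀ ≠ 0 →
        h * (x₀ * Θ x₀) + ρ (h * (x₀ * Θ x₀)) ≠ 0 →
        jE a = ρ (lam - jE ((u : Matrix (Fin 1) (Fin 1) E) 0 0)) + ((lam - jE ((u : Matrix (Fin 1) (Fin 1) E) 0 0)) - ρ (lam - jE ((u : Matrix (Fin 1) (Fin 1) E) 0 0))) *
          (ρ (h * (x₀ * Θ x₀)) / (h * (x₀ * Θ x₀) + ρ (h * (x₀ * Θ x₀)))) →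
        (NX Λ ↔ Valued.v (pairing σ H₂ w₀ w₀) * Valued.v a = Valued.v ϖ ^ (d % 2)) ∧
          ∀ e' : E, σ e' = e' → Valued.v e' = 1 →
            Valued.v (pairing σ H₂ w₀ w₀ * a - e' * ((ϖ - σ ϖ) * ((ϖ * σ ϖ) ^ ((d - d % 2) / 2))⁻¹)) ≤ Valued.v ϖ ^ mstarOfRecord d →
            (Pc Λ ↔ ∃ c : E, c * σ c = -(e' / pairing σ H₂ w₀ w₀) / hW) := by
  have hvϖ0 : Valued.v ϖ ≠ 0 := by rw [hϖ]; exact exp_ne_zero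
  have hϖ0 : ϖ ≠ 0 := fun h0 => hvϖ0 (by rw [h0, map_zero])
  have hhW0 : hW ≠ 0 := fun h0 => by rw [h0, map_zero] at hhW; exact zero_ne_one hhW
  have hρϖ : ρ (jE ϖ) = jE ϖ := (hjfix _).2 ⟨ϖ, rfl⟩
  have hc : ρ (jE ϖ ^ j) = jE ϖ ^ j := by rw [map_pow, hρϖ]
  have hc0 : jE ϖ ^ j ≠ 0 := pow_ne_zero j ((map_ne_zero jE).2 hϖ0)
  have H := exactDigit_and_prodClass_of_presentation σ hσ hvσ hϖ hD h2 h2v hH₂ hH₂σ hhW hhWσ jE hρρ hvρ hα hα1 hint hΘΘ hΘρ hvΘ hΘj hjv hjiso hjfix hjpow hϖmax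
    φ hφs hφi hφo hφγ hlam hΘh hh hform hlam2 hρlam u P₁ hA hΓ hn hu1N hlam1 hb1 hdb hlamj hμl hlamρ hμk hprod f hf NX hNX Pc hPc z hz1 ξ₀ hzξ hσξ hξN
  intro Λ hΛ x₀ r₀ w₀ a hx₀ hΛx hyO hyp hylev hσr₀ hr₀1 hr₀ hw₀ hσpw hpw0 ht ha
  -- a ray scalar on `x₀`, and `e₀ = ⟨w₀,w₀⟩·a` (★ p864871 HEAD 1, `jE` injective)
  obtain ⟨e₀, he₀⟩ : ∃ e₀ : E, jE e₀ = (lam - jE ((u : Matrix (Fin 1) (Fin 1) E) 0 0)) / (jE ϖ ^ j * (α - ρ α) * Θ (dualGen ρ Θ α (jE ϖ ^ j) h x₀)) +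
      ρ ((lam - jE ((u : Matrix (Fin 1) (Fin 1) E) 0 0)) / (jE ϖ ^ j * (α - ρ α) * Θ (dualGen ρ Θ α (jE ϖ ^ j) h x₀))) :=
    (hjfix _).1 (by rw [map_add, hρρ, add_comm])
  obtain ⟨a', ha', hea'⟩ := rayScalar_eq_pairing_mul_on_E hρρ hΘΘ hΘρ σ H₂ jE hjfix φ hΘh hh hform hc hc0 hα hx₀ hw₀ he₀ ht
  have haa : a' = a := jE.injective (by rw [ha', ha])
  rw [haa] at hea'
  obtain ⟨hA, hB⟩ := H Λ hΛ x₀ r₀ e₀ hx₀ hΛx hyO hyp hylev hσr₀ hr₀1 hr₀ he₀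
  refine ⟨hA.trans (v_rayScalar_eq_iff_of_eq hea' _), fun e' hσe' he'1 hclose => ?_⟩
  rw [← hea'] at hclose
  exact (hB e' hσe' he'1 hclose).trans (prodClass_iff_digitClass σ H₂ jE hΘj φ hform hw₀ hϖ0 hhW0 b hr₀ hσpw hpw0 e')

end Summit.HodgeConjecture.HodgeConjecture.Cruxes.H413.F0P3cDyRamMixBandDigitReads

end
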